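/-
Copyright (c) 2026. All rights reserved.
Released under Apache 2.0 license as described in the file LICENSE.
-/
import Literature.NumberTheory.Automorphic.EichlerOrderAutomorphisms
import HarnessLib

/-!
# The normaliser and the automorphisms of an Eichler order act on its right ideal classes through the Atkin–Lehner
# involutions of their supports: `[u I u⁻¹] = W_{supp u} [I]` (Voight Lemma 18.5.1, Prop. 18.5.10; Martin §4.1)

[tag: quaternion_algebra] [tag: eichler_order] [tag: class_number] [tag: hecke_operator]

Topic `NumberTheory/Automorphic`; THEOREMS ONLY (no definition, no named fact, no instance, no notation; net debt `0`).
Lane `lit-hodgefound`, seat p12, gen 54 — for the Eichler order `O` of a Brandt setup `S : XiSetup N⁺ N⁻` (definite quaternion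
algebra `D` over `ℚ` of discriminant `N⁻`, Eichler order of level `N⁺`), on top of `EichlerOrderTwoSidedIdealsNormaliser.lean`
(Lemma 18.5.1: `x ∈ N(O)` generates `O P_l(O)` up to `ℚ^×`; `O P_l · O P_l = (∏ localNorm) O`),
`BrandtSetupTwoSidedIdealTransport.lean` (`(W_{r_k} ∘ ⋯ ∘ W_{r_1})[I] = [I P_l(O)]`) and `EichlerOrderAutomorphisms.lean`
(`Aut(O) = N(O)/ℚ^×`, the support of an automorphism).

THE PRINTED STATEMENTS (J. Voight, *Quaternion Algebras*, GTM 288). **Lemma 18.5.1**: `α ∈ N_{B^×}(O)` iff `αO = Oα` iff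
`OαO` is principal. **Prop. 18.5.10** and its proof (p. 298): the fibre of `Cls O → Typ O` over `O′` is `PIdl(O′) \ Idl(O′)` via
`J′ ↦ [J′I]`, and «`O_L(αI′) = αO′α⁻¹` for `α ∈ B^×` … `[J′I] = [K′I]` if and only if `α′ ∈ N_{B^×}(O′)`». K. Martin,
*Canad. J. Math.* 70 (2018) §4.1: the group `(ℤ/2ℤ)^T` of local involutions `W_r` (`[I] ↦ [I T_r]`) acting on `Cls O`.

For `y` with `O P_l(O) = yO` (so `y ∈ N(O)`), for a general `u ∈ N(O)` (`u O u⁻¹ = O`) with support data `O P_l(O) = (q u)O`,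
and for an automorphism `σ` of `O` (`σ(a) ∈ O ⟺ a ∈ O`, `σ = u · u⁻¹`) with support `s`, this file proves:

* §1 **THE CONJUGATE OF A RIGHT IDEAL: `y I y⁻¹ = (n⁻¹ y) · I P_l(O)`**, `n = ∏_{r ∈ l} localNorm r`, for every right `O`-ideal
  `I` (`XiSetup.exists_units_conj_eq_smul_mul_twoSidedIdealProd`: `I y⁻¹ = I · y⁻¹O` and `y⁻¹O = n⁻¹ · O P_l(O)`); hence
  `u I u⁻¹` is again a right `O`-ideal (`XiSetup.units_conj_mem_rightIdeals_of_conj_eq`);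
* §2 **ON CLASSES: `[u I u⁻¹] = (W_{r_k} ∘ ⋯ ∘ W_{r_1})[I] = W_{supp u}[I]`** for `u ∈ N(O)` with support `l = [r_1, …, r_k]`
  (`XiSetup.mk_units_conj_eq_foldl_atkinLehner`): the normaliser acts on `Cls O` through `N(O)/ℚ^×O^× ↪ (ℤ/2ℤ)^{ω(N)}` and
  the Atkin–Lehner involutions; units of `O` (empty support) act trivially;
* §3 **AUTOMORPHISMS: the image `σ(I)` of a right `O`-ideal under `σ ∈ Aut(O)` is a right `O`-ideal with
  `[σ(I)] = W_{supp σ}[I]`** (`XiSetup.mk_map_eq_foldl_atkinLehner_of_support`); inner automorphisms act trivially on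
  `Cls O` (`XiSetup.mk_map_eq_self_of_inner`).

## References

* [Voight2021] J. Voight, *Quaternion Algebras*, GTM 288 (2021): Lemma 18.5.1, Prop. 18.5.3, Prop. 18.5.10 (and proof),
  (23.4.20).
* [Martin2018] K. Martin, *Congruences for modular forms mod 2 and quaternionic `S`-ideal classes*, Canad. J. Math. 70 (2018),
  §4.1 (the local involutions and the action of `(ℤ/2ℤ)^S` on `Cls O`).
* [VignerasLNM800] M.-F. Vignéras, *Arithmétique des algèbres de quaternions*, LNM 800 (1980), Ch. III §5 exercice 5.8.

## Scope (honest)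

Theorems only; the action of `Aut(O)` on `Cls O` is not built as a `MulAction` — the statements are class identities for the
image lattices `u • (op u⁻¹ • I)` and `I.map σ`.
-/

noncomputable section

open scoped Pointwise

universe u

namespace Literature.NumberTheory.Automorphic

open AtkinLehner

namespace Brandt

variable {Nplus Nminus : ℕ} (S : XiSetup Nplus Nminus)

/-! ## §0 Elementary lemmas -/

/-- The product of local norms over a list of primes is non-zero. [folklore] -/
private theorem prod_localNorm_ne_zero₆₄ {l : List ℕ} (hl : ∀ r ∈ l, r.Prime) : (l.map (localNorm Nplus Nminus)).prod ≠ 0 :=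
  List.prod_ne_zero fun h => by
    obtain ⟨r', hr', h0⟩ := List.mem_map.mp h
    exact localNorm_ne_zero (hl r' hr').ne_zero h0

/-- A central unit `ν = n · 1` acts as the integer `n`: `ν J = n J`. [folklore] -/
private theorem units_smul_eq_natCast_smul₆₄ {D : Type u} [Ring D] {ν : Dˣ} {n : ℕ} (hν : (ν : D) = (n : ℤ))
    (J : Submodule ℤ D) : ν • J = (n : ℤ) • J := by
  ext x
  constructor
  · intro hx
    obtain ⟨y, hy, rfl⟩ := exists_eq_zsmul_of_mem_units_smul hν hx
    exact Submodule.smul_mem_pointwise_smul y _ J hy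
  · intro hx
    obtain ⟨y, hy, rfl⟩ := (Submodule.mem_smul_pointwise_iff_exists x _ J).mp hx
    exact units_smul_eq_zsmul_of_val_eq hν J hy

/-- For a unit `ν` commuting with everything, left and right translation agree: `op ν • M = ν • M`. [folklore] -/
private theorem op_smul_eq_units_smul_of_forall_commute₆₄ {D : Type u} [Ring D] {ν : Dˣ}
    (hν' : ∀ a : D, a * ν = ν * a) (M : Submodule ℤ D) : MulOpposite.op (ν : D) • M = ν • M := by
  ext x
  have hinv : ∀ a : D, a * ((ν⁻¹ : Dˣ) : D) = ((ν⁻¹ : Dˣ) : D) * a := fun a =>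
    calc a * ((ν⁻¹ : Dˣ) : D) = ((ν⁻¹ : Dˣ) : D) * ((ν : D) * a) * ((ν⁻¹ : Dˣ) : D) := by rw [Units.inv_mul_cancel_left]
      _ = ((ν⁻¹ : Dˣ) : D) * (a * (ν : D)) * ((ν⁻¹ : Dˣ) : D) := by rw [← hν' a]
      _ = ((ν⁻¹ : Dˣ) : D) * a := by rw [← mul_assoc, Units.mul_inv_cancel_right]
  rw [mem_op_units_smul_submodule_iff, mem_units_smul_submodule_iff, Units.smul_def, smul_eq_mul, hinv]

/-- The central unit `n · 1` (`n ≥ 1`) and its basic properties. [folklore] -/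
private theorem exists_central_units₆₄ {D : Type u} [Ring D] [Algebra ℚ D] [IsQuaternionAlgebra ℚ D] {n : ℕ} (hn : n ≠ 0) :
    ∃ ν : Dˣ, (ν : D) = (n : ℤ) ∧ (∀ α : Dˣ, α * ν = ν * α) ∧ (∀ a : D, a * ν = ν * a) ∧
      ((ν⁻¹ : Dˣ) : D) = algebraMap ℚ D (n : ℚ)⁻¹ := by
  obtain ⟨ν, hν, hνc⟩ := exists_units_val_eq_natCast (D := D) hn
  have hνq : (ν : D) = algebraMap ℚ D (n : ℚ) := by rw [map_natCast, hν, Int.cast_natCast]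
  refine ⟨ν, hν, hνc, fun a => by rw [hνq]; exact (Algebra.commutes (n : ℚ) a).symm, ?_⟩
  exact Units.inv_eq_of_mul_eq_one_right (by rw [hνq, ← map_mul, mul_inv_cancel₀ (by exact_mod_cast hn : (n : ℚ) ≠ 0), map_one])

/-- `I O = I` for a right `O`-ideal `I`. [folklore] -/
private theorem XiSetup.mul_order_eq_self₆₄ {I : Submodule ℤ S.D} (hI : I ∈ rightIdeals S.O) : I * S.O = I := by
  have h := Brandt.mul_rightOrder_self I
  rwa [hI.2.1] at h

/-- Conjugation by `c u` with `c` central equals conjugation by `u` on lattices: `y M y⁻¹ = u M u⁻¹` for `y = q u`. [folklore] -/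
private theorem units_conj_eq_of_eq_algebraMap_mul₆₄ {D : Type u} [Ring D] [Algebra ℚ D] {q : ℚ} (hq : q ≠ 0) {u y : Dˣ}
    (hy : (y : D) = algebraMap ℚ D q * u) (M : Submodule ℤ D) :
    y • (MulOpposite.op ((y⁻¹ : Dˣ) : D) • M) = u • (MulOpposite.op ((u⁻¹ : Dˣ) : D) • M) := by
  have hc : IsUnit (algebraMap ℚ D q) := (IsUnit.mk0 q hq).map _
  have hyu : y = hc.unit * u := Units.ext (by rw [Units.val_mul, hc.unit_spec, hy])
  have hcinv : ((hc.unit⁻¹ : Dˣ) : D) = algebraMap ℚ D q⁻¹ :=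
    Units.inv_eq_of_mul_eq_one_right (by rw [hc.unit_spec, ← map_mul, mul_inv_cancel₀ hq, map_one])
  have key : ∀ x : D, algebraMap ℚ D q⁻¹ * x * (algebraMap ℚ D q * u) = x * u := fun x => by
    rw [← mul_assoc, mul_assoc (algebraMap ℚ D q⁻¹), ← Algebra.commutes q x, ← mul_assoc, ← map_mul, inv_mul_cancel₀ hq,
      map_one, one_mul]
  ext x
  rw [mem_units_conj_iff, mem_units_conj_iff, hyu, mul_inv_rev, Units.val_mul, Units.val_mul, hc.unit_spec, hcinv,
    mul_assoc ((u⁻¹ : Dˣ) : D) (algebraMap ℚ D q⁻¹) x, mul_assoc ((u⁻¹ : Dˣ) : D) (algebraMap ℚ D q⁻¹ * x), key, ← mul_assoc]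

/-! ## §1 The conjugate of a right ideal by a normaliser element -/

/-- **`y I y⁻¹ = (n⁻¹ y) · I P_l(O)` when `O P_l(O) = yO`** (`l` a list of primes, `n = ∏_{r ∈ l} localNorm r`, `I` a right
`O`-ideal): `I y⁻¹ = I · Oy⁻¹ = I · y⁻¹O` (`y` normalises `O`) and `y⁻¹ O = n⁻¹ · O P_l(O)` (`(O P_l)² = nO`).
[cite: Voight2021, Lemma 18.5.1 and Prop. 18.5.10 (proof)] [cite: Martin2018, §4.1] -/
theorem XiSetup.exists_units_conj_eq_smul_mul_twoSidedIdealProd {l : List ℕ} (hl : ∀ r ∈ l, r.Prime) {y : S.Dˣ}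
    (h : S.O * S.twoSidedIdealProd S.O l = y • S.O) {I : Submodule ℤ S.D} (hI : I ∈ rightIdeals S.O) :
    ∃ z : S.Dˣ, (z : S.D) = algebraMap ℚ S.D (((l.map (localNorm Nplus Nminus)).prod : ℕ) : ℚ)⁻¹ * y ∧
      y • (MulOpposite.op ((y⁻¹ : S.Dˣ) : S.D) • I) = z • (I * S.twoSidedIdealProd S.O l) := by
  have hO := S.isZOrder_O
  set n := (l.map (localNorm Nplus Nminus)).prod with hn
  obtain ⟨ν, hν, hνc, hνc', hνinv⟩ := exists_central_units₆₄ (D := S.D) (prod_localNorm_ne_zero₆₄ hl)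
  have hνci : ∀ α : S.Dˣ, α * ν⁻¹ = ν⁻¹ * α := fun α => by rw [mul_inv_eq_iff_eq_mul, mul_assoc, hνc α, inv_mul_cancel_left]
  have hνci' : ∀ a : S.D, a * ((ν⁻¹ : S.Dˣ) : S.D) = ((ν⁻¹ : S.Dˣ) : S.D) * a := fun a => by
    rw [hνinv]; exact (Algebra.commutes _ a).symm
  have hy : y • (MulOpposite.op ((y⁻¹ : S.Dˣ) : S.D) • S.O) = S.O := S.units_conj_eq_of_order_mul_twoSidedIdealProd_eq_units_smul hl h
  -- `op y⁻¹ • O = y⁻¹ • O`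
  have hop : MulOpposite.op ((y⁻¹ : S.Dˣ) : S.D) • S.O = y⁻¹ • S.O := eq_inv_smul_iff.mpr hy
  -- `(y y) O = n O`
  have hsq : (y * y) • S.O = ν • S.O := by
    have key := S.order_mul_twoSidedIdealProd_mul_self hl
    rw [h, smul_mul_assoc, ← h, ← mul_assoc, hO.mul_self, h, ← mul_smul, ← hn, ← units_smul_eq_natCast_smul₆₄ hν] at key
    exact key
  -- `y⁻¹ O = (ν⁻¹ y) O`
  have hinv : y⁻¹ • S.O = (ν⁻¹ * y) • S.O := by
    have e : ν⁻¹ * y = y⁻¹ * ν⁻¹ * (y * y) := by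
      rw [hνci y⁻¹, mul_assoc, ← mul_assoc y⁻¹ y y, inv_mul_cancel, one_mul]
    rw [e, mul_smul, mul_smul, hsq, inv_smul_smul]
  refine ⟨ν⁻¹ * y, by rw [Units.val_mul, hνinv], ?_⟩
  calc y • (MulOpposite.op ((y⁻¹ : S.Dˣ) : S.D) • I)
      = y • (I * (MulOpposite.op ((y⁻¹ : S.Dˣ) : S.D) • S.O)) := by rw [mul_op_smul_eq_op_smul_mul, S.mul_order_eq_self₆₄ hI]
    _ = y • (I * (ν⁻¹ • (S.O * S.twoSidedIdealProd S.O l))) := by rw [hop, hinv, mul_smul, h]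
    _ = y • (ν⁻¹ • (I * S.twoSidedIdealProd S.O l)) := by
        rw [← op_smul_eq_units_smul_of_forall_commute₆₄ hνci' (S.O * S.twoSidedIdealProd S.O l),
          mul_op_smul_eq_op_smul_mul, op_smul_eq_units_smul_of_forall_commute₆₄ hνci', ← mul_assoc,
          S.mul_order_eq_self₆₄ hI]
    _ = (ν⁻¹ * y) • (I * S.twoSidedIdealProd S.O l) := by rw [← mul_smul, hνci y]

/-- **`u I u⁻¹` is a right `O`-ideal for `u ∈ N(O)`** and every right `O`-ideal `I`. [cite: Voight2021, Lemma 18.5.1 and Prop. 18.5.10 (proof)] -/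
theorem XiSetup.units_conj_mem_rightIdeals_of_conj_eq {u : S.Dˣ} (hu : u • (MulOpposite.op ((u⁻¹ : S.Dˣ) : S.D) • S.O) = S.O)
    {I : Submodule ℤ S.D} (hI : I ∈ rightIdeals S.O) : u • (MulOpposite.op ((u⁻¹ : S.Dˣ) : S.D) • I) ∈ rightIdeals S.O := by
  obtain ⟨l, -, hl, q, y, hq, hy, h⟩ := S.exists_order_mul_twoSidedIdealProd_eq_units_smul_of_conj_eq hu
  obtain ⟨z, -, hz⟩ := S.exists_units_conj_eq_smul_mul_twoSidedIdealProd (fun r hr => (hl r hr).1) h hI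
  rw [← units_conj_eq_of_eq_algebraMap_mul₆₄ hq.ne' hy, hz]
  exact Brandt.units_smul_mem_rightIdeals_of_isTotallyDefinite S.isTotallyDefinite S.isEichlerOrder.isOrder
    (S.mul_twoSidedIdealProd_mem (fun r hr => (hl r hr).1) hI) z

/-! ## §2 On classes: conjugation by `u ∈ N(O)` is the Atkin–Lehner operator of its support -/

/-- **`[y I y⁻¹] = (W_{r_k} ∘ ⋯ ∘ W_{r_1})[I] = [I P_l(O)]` when `O P_l(O) = yO`** (`l = [r_1, …, r_k]` primes).
[cite: Voight2021, Prop. 18.5.10 (proof) and Lemma 18.5.1] [cite: Martin2018, §4.1] -/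
theorem XiSetup.mk_units_conj_eq_foldl_atkinLehner_of_eq {l : List ℕ} (hl : ∀ r ∈ l, r.Prime) {y : S.Dˣ}
    (h : S.O * S.twoSidedIdealProd S.O l = y • S.O) {I : Submodule ℤ S.D} (hI : I ∈ rightIdeals S.O)
    (hmem : y • (MulOpposite.op ((y⁻¹ : S.Dˣ) : S.D) • I) ∈ rightIdeals S.O) :
    (Quotient.mk (rightClassSetoid S.O) ⟨y • (MulOpposite.op ((y⁻¹ : S.Dˣ) : S.D) • I), hmem⟩ : ClassSet S.O) =
      l.foldl (fun c r => S.atkinLehner r c) (Quotient.mk (rightClassSetoid S.O) ⟨I, hI⟩) := by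
  obtain ⟨z, -, hz⟩ := S.exists_units_conj_eq_smul_mul_twoSidedIdealProd hl h hI
  rw [S.foldl_atkinLehner_mk hl ⟨I, hI⟩]
  refine Quotient.sound ⟨z⁻¹, ?_⟩
  change I * S.twoSidedIdealProd S.O l = z⁻¹ • (y • (MulOpposite.op ((y⁻¹ : S.Dˣ) : S.D) • I))
  rw [hz, inv_smul_smul]

/-- **THE NORMALISER ACTS ON `Cls O` THROUGH THE ATKIN–LEHNER INVOLUTIONS OF ITS SUPPORT: `[u I u⁻¹] = W_{supp u}[I]`** — for
`u ∈ N(O)` with support data `O P_l(O) = (q u) O` (`q > 0`, `l` primes) and every right `O`-ideal `I`,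
`[u I u⁻¹] = (W_{r_k} ∘ ⋯ ∘ W_{r_1})[I]`. [cite: Voight2021, Lemma 18.5.1, Prop. 18.5.3 and Prop. 18.5.10 (proof)] [cite: Martin2018, §4.1] -/
theorem XiSetup.mk_units_conj_eq_foldl_atkinLehner {u y : S.Dˣ} {l : List ℕ} (hl : ∀ r ∈ l, r.Prime) {q : ℚ} (hq : 0 < q)
    (hy : (y : S.D) = algebraMap ℚ S.D q * u) (h : S.O * S.twoSidedIdealProd S.O l = y • S.O) {I : Submodule ℤ S.D}
    (hI : I ∈ rightIdeals S.O) (hmem : u • (MulOpposite.op ((u⁻¹ : S.Dˣ) : S.D) • I) ∈ rightIdeals S.O) :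
    (Quotient.mk (rightClassSetoid S.O) ⟨u • (MulOpposite.op ((u⁻¹ : S.Dˣ) : S.D) • I), hmem⟩ : ClassSet S.O) =
      l.foldl (fun c r => S.atkinLehner r c) (Quotient.mk (rightClassSetoid S.O) ⟨I, hI⟩) := by
  have hmem' : y • (MulOpposite.op ((y⁻¹ : S.Dˣ) : S.D) • I) ∈ rightIdeals S.O := by
    rw [units_conj_eq_of_eq_algebraMap_mul₆₄ hq.ne' hy]; exact hmem
  rw [← S.mk_units_conj_eq_foldl_atkinLehner_of_eq hl h hI hmem']
  congr 1
  exact Subtype.ext (units_conj_eq_of_eq_algebraMap_mul₆₄ hq.ne' hy I).symm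

/-- **Every `u ∈ N(O)` acts on `Cls O` as a product of Atkin–Lehner involutions**: there is a duplicate-free list `l` of primes
of `N⁺N⁻` (its support) with `[u I u⁻¹] = (W_{r_k} ∘ ⋯ ∘ W_{r_1})[I]` for EVERY right `O`-ideal `I`.
[cite: Voight2021, Lemma 18.5.1, Prop. 18.5.3 and Prop. 18.5.10] [cite: Martin2018, §4.1] -/
theorem XiSetup.exists_forall_mk_units_conj_eq_foldl_atkinLehner {u : S.Dˣ}
    (hu : u • (MulOpposite.op ((u⁻¹ : S.Dˣ) : S.D) • S.O) = S.O) :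
    ∃ l : List ℕ, l.Nodup ∧ (∀ r ∈ l, r.Prime ∧ r ∣ Nplus * Nminus) ∧ ∀ (I : Submodule ℤ S.D) (hI : I ∈ rightIdeals S.O),
      (Quotient.mk (rightClassSetoid S.O) ⟨u • (MulOpposite.op ((u⁻¹ : S.Dˣ) : S.D) • I),
          S.units_conj_mem_rightIdeals_of_conj_eq hu hI⟩ : ClassSet S.O) =
        l.foldl (fun c r => S.atkinLehner r c) (Quotient.mk (rightClassSetoid S.O) ⟨I, hI⟩) := by
  obtain ⟨l, hnd, hl, q, y, hq, hy, h⟩ := S.exists_order_mul_twoSidedIdealProd_eq_units_smul_of_conj_eq hu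
  exact ⟨l, hnd, hl, fun I hI => S.mk_units_conj_eq_foldl_atkinLehner (fun r hr => (hl r hr).1) hq hy h hI _⟩

/-- **Units of `O` act trivially on `Cls O`**: `[w I w⁻¹] = [I]` for `w ∈ Stab(O) = O^×` (empty support).
[cite: Voight2021, Lemma 18.5.1 and Prop. 18.5.10 (proof)] -/
theorem XiSetup.mk_units_conj_eq_self_of_mem_stabilizer {w : S.Dˣ} (hw : w ∈ MulAction.stabilizer S.Dˣ S.O)
    {I : Submodule ℤ S.D} (hI : I ∈ rightIdeals S.O) (hmem : w • (MulOpposite.op ((w⁻¹ : S.Dˣ) : S.D) • I) ∈ rightIdeals S.O) :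
    (Quotient.mk (rightClassSetoid S.O) ⟨w • (MulOpposite.op ((w⁻¹ : S.Dˣ) : S.D) • I), hmem⟩ : ClassSet S.O) =
      Quotient.mk (rightClassSetoid S.O) ⟨I, hI⟩ := by
  have h : S.O * S.twoSidedIdealProd S.O [] = w • S.O := by
    rw [S.twoSidedIdealProd_nil, mul_one]; exact (MulAction.mem_stabilizer_iff.mp hw).symm
  rw [S.mk_units_conj_eq_foldl_atkinLehner_of_eq (l := []) (by simp) h hI hmem, List.foldl_nil]

/-! ## §3 Automorphisms of `O` act on `Cls O` through `Aut(O)/Inn(O) ↪ (ℤ/2ℤ)^{ω(N)}` -/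

/-- **The image of a lattice under `σ = u · u⁻¹` is the conjugate lattice `u M u⁻¹`.** [cite: Voight2021, Cor. 7.7.4] -/
theorem XiSetup.map_eq_units_conj {σ : S.D →ₐ[ℚ] S.D} {u : S.Dˣ} (hσu : ∀ a : S.D, σ a = u * a * ((u⁻¹ : S.Dˣ) : S.D))
    (M : Submodule ℤ S.D) : M.map (σ.toLinearMap.restrictScalars ℤ) = u • (MulOpposite.op ((u⁻¹ : S.Dˣ) : S.D) • M) := by
  ext x
  rw [Submodule.mem_map, mem_units_conj_iff]
  constructor
  · rintro ⟨m, hm, rfl⟩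
    rw [LinearMap.restrictScalars_apply, AlgHom.toLinearMap_apply, hσu, ← mul_assoc, ← mul_assoc, Units.inv_mul, one_mul,
      Units.inv_mul_cancel_right]
    exact hm
  · intro hx
    refine ⟨_, hx, ?_⟩
    rw [LinearMap.restrictScalars_apply, AlgHom.toLinearMap_apply, hσu, ← mul_assoc, ← mul_assoc, Units.mul_inv, one_mul,
      Units.mul_inv_cancel_right]

/-- **An automorphism of `O` maps right `O`-ideals to right `O`-ideals.** [cite: Voight2021, Cor. 7.7.4 and Lemma 18.5.1] -/
theorem XiSetup.map_mem_rightIdeals_of_forall_mem_iff {σ : S.D →ₐ[ℚ] S.D} (hσ : ∀ a, σ a ∈ S.O ↔ a ∈ S.O)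
    {I : Submodule ℤ S.D} (hI : I ∈ rightIdeals S.O) : I.map (σ.toLinearMap.restrictScalars ℤ) ∈ rightIdeals S.O := by
  obtain ⟨u, hu, hσu⟩ := S.exists_conj_eq_and_forall_eq_conj_of_forall_mem_iff σ hσ
  rw [S.map_eq_units_conj hσu]
  exact S.units_conj_mem_rightIdeals_of_conj_eq hu hI

/-- **`[σ(I)] = W_{supp σ}[I]`: an automorphism `σ` of `O` with support data `(s, u, q, y)` (`σ = u · u⁻¹`,
`O P_{sort s}(O) = (q u) O`, as in `EichlerOrderAutomorphisms`) maps the class of every right `O`-ideal `I` to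
`(∏_{r ∈ s} W_r)[I]`.** [cite: Voight2021, Prop. 18.5.3 and Prop. 18.5.10 (proof)] [cite: Martin2018, §4.1] -/
theorem XiSetup.mk_map_eq_foldl_atkinLehner_of_support {σ : S.D →ₐ[ℚ] S.D} {u y : S.Dˣ} {s : Finset ℕ} {q : ℚ}
    (hσu : ∀ a : S.D, σ a = u * a * ((u⁻¹ : S.Dˣ) : S.D)) (hs : s ⊆ (Nplus * Nminus).primeFactors) (hq : 0 < q)
    (hy : (y : S.D) = algebraMap ℚ S.D q * u) (h : S.O * S.twoSidedIdealProd S.O (s.sort (· ≤ ·)) = y • S.O)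
    {I : Submodule ℤ S.D} (hI : I ∈ rightIdeals S.O) (hmem : I.map (σ.toLinearMap.restrictScalars ℤ) ∈ rightIdeals S.O) :
    (Quotient.mk (rightClassSetoid S.O) ⟨I.map (σ.toLinearMap.restrictScalars ℤ), hmem⟩ : ClassSet S.O) =
      (s.sort (· ≤ ·)).foldl (fun c r => S.atkinLehner r c) (Quotient.mk (rightClassSetoid S.O) ⟨I, hI⟩) := by
  have hl : ∀ r ∈ s.sort (· ≤ ·), r.Prime := fun r hr => (Nat.mem_primeFactors.mp (hs ((Finset.mem_sort _).mp hr))).1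
  have hmem' : u • (MulOpposite.op ((u⁻¹ : S.Dˣ) : S.D) • I) ∈ rightIdeals S.O := by rw [← S.map_eq_units_conj hσu]; exact hmem
  rw [← S.mk_units_conj_eq_foldl_atkinLehner hl hq hy h hI hmem']
  congr 1
  exact Subtype.ext (S.map_eq_units_conj hσu I)

/-- **Inner automorphisms act trivially on `Cls O`: `[σ(I)] = [I]` for `σ = w · w⁻¹`, `w ∈ O^×`.** [cite: Voight2021, Lemma 18.5.1 and Prop. 18.5.10 (proof)] -/
theorem XiSetup.mk_map_eq_self_of_inner {σ : S.D →ₐ[ℚ] S.D} {w : S.Dˣ} (hw : w ∈ MulAction.stabilizer S.Dˣ S.O)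
    (hσw : ∀ a : S.D, σ a = (w : S.D) * a * ((w⁻¹ : S.Dˣ) : S.D)) {I : Submodule ℤ S.D} (hI : I ∈ rightIdeals S.O)
    (hmem : I.map (σ.toLinearMap.restrictScalars ℤ) ∈ rightIdeals S.O) :
    (Quotient.mk (rightClassSetoid S.O) ⟨I.map (σ.toLinearMap.restrictScalars ℤ), hmem⟩ : ClassSet S.O) =
      Quotient.mk (rightClassSetoid S.O) ⟨I, hI⟩ := by
  have hmem' : w • (MulOpposite.op ((w⁻¹ : S.Dˣ) : S.D) • I) ∈ rightIdeals S.O := by rw [← S.map_eq_units_conj hσw]; exact hmem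
  rw [← S.mk_units_conj_eq_self_of_mem_stabilizer hw hI hmem']
  congr 1
  exact Subtype.ext (S.map_eq_units_conj hσw I)

/-- **Every automorphism of `O` acts on `Cls O` as a product of Atkin–Lehner involutions indexed by a subset of the primes of
`N⁺N⁻`.** [cite: Voight2021, Prop. 18.5.3 and Prop. 18.5.10] [cite: Martin2018, §4.1] -/
theorem XiSetup.exists_forall_mk_map_eq_foldl_atkinLehner {σ : S.D →ₐ[ℚ] S.D} (hσ : ∀ a, σ a ∈ S.O ↔ a ∈ S.O) :
    ∃ s : Finset ℕ, s ⊆ (Nplus * Nminus).primeFactors ∧ ∀ (I : Submodule ℤ S.D) (hI : I ∈ rightIdeals S.O),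
      (Quotient.mk (rightClassSetoid S.O) ⟨I.map (σ.toLinearMap.restrictScalars ℤ), S.map_mem_rightIdeals_of_forall_mem_iff hσ hI⟩ :
          ClassSet S.O) =
        (s.sort (· ≤ ·)).foldl (fun c r => S.atkinLehner r c) (Quotient.mk (rightClassSetoid S.O) ⟨I, hI⟩) := by
  obtain ⟨s, ⟨hs, u, hσu, q, y, hq, hy, h⟩, -⟩ := S.existsUnique_finset_support_of_forall_mem_iff σ hσ
  exact ⟨s, hs, fun I hI => S.mk_map_eq_foldl_atkinLehner_of_support hσu hs hq hy h hI _⟩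

end Brandt

end Literature.NumberTheory.Automorphic
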